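import Mathlib
import Summits.Ventures.PercRepro2.Defs
import Summits.Ventures.PercRepro2.Harris
import Summits.Ventures.PercRepro2.Graph
import Summits.Ventures.PercRepro2.Events
import Summits.Ventures.PercRepro2.CondAvoidPA
import Summits.Ventures.PercRepro2.MixedBoxDefs
import Summits.Ventures.PercRepro2.ReachClosure
import Summits.Ventures.PercRepro2.ReachBits
import Summits.Ventures.PercRepro2.CellMonoRefutation

/-!
# Two log-supermodular pairs of the three-status law are FALSE: a kernel-checked refutation of the
pair `(NNS, NSN)` and of its mirror `(NNT, NTN)` — the lane's candidate (MIX-1)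
(blind cell PercRepro2, mine-1 g51; proofs/MINE1-LSMPAIRS.md §10, MINE-1.md §68)

For cells `a, b` of the status grid of three observed vertices `u, v, w` on `{s ↮ t}` (`status`:
`2` = in the cluster of `s`, `0` = in the cluster of `t`, `1` = in neither; `MixedBoxDefs`), the
LOG-SUPERMODULAR PAIR inequality is

  `P(σ = a, s ↮ t) · P(σ = b, s ↮ t) ≤ P(σ = a ∨ b, s ↮ t) · P(σ = a ∧ b, s ↮ t)`   (`LSMPair a b`)

with `∨, ∧` the coordinatewise `max, min` in the order `T < N < S` (`0 < 1 < 2`).  Nine of the twelve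
census-surviving pairs on three coordinates are theorems (`LSMPairTheorems.lean`,
`BHKAntitoneCross.lean`); this file refutes the pair `a = (N, N, S)`, `b = (N, S, N)` (join
`(N, S, S)`, meet `(N, N, N)`), i.e. the positive association of `{v ∈ C_s}` and `{w ∈ C_s}` given
that `u` lies in neither cluster and `t` avoids `v, w` — and, by exchanging the roots, its mirror
`a = (N, N, T)`, `b = (N, T, N)`: the positive association of `{σ_v = N}` and `{σ_w = N}` in the box
`{σ_u, σ_v, σ_w ∈ {T, N}}` (the cluster of `s` avoids `u, v, w`) given `σ_u = N` — the cell's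
candidate lemma (MIX-1) of MINE1-UNIONROW-K3.md §15.4 (census-true on 12,000 instances, n ≤ 7).

THE WITNESS (found by the tropical falsifier at `n = 10`, reduced greedily to this graph): seven
vertices, the eight edges `4–6, 4–5, 2–5, 3–0, 0–4, 3–4, 2–3, 3–1` with weights
`4095/4096, 1/2, 1/2, 255/256, 4095/4096, 1/2, 1/2, 1/2`; roots `s = 2`, `t = 0`; observed
`u = 6`, `v = 1`, `w = 5`.  Over the `2⁸` configurations, with the integer weight
`wt(ω) = ∏_e (num_e if e open else den_e − num_e)` and `D = ∏_e den_e = 2³⁷`: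
`m(NNS) = 3170307 · 2⁰`, `m(NSN) = 3 · 2¹²`, `m(NSS) = 2049 · 2²`, `m(NNN) = 2117503 · 2¹`
(in units of `2⁻³⁷`), so `m(NSS) m(NNN) − m(NNS) m(NSN) = −530827905 · 2³ < 0` — exactly
`−530827905 / 2⁷¹` in probability units.  Mechanism: `v` (`= 1`) hangs on `3` by a single fair edge,
`w` (`= 5`) is joined to `s` by a fair edge and to the hub `4`; the near-certain edges `4–6`, `0–4`
and the near-certain `3–0` tie `u` and the hub to `t` unless cut: given `u ∈ N` the hub must be
severed from `t` or from `u`, which makes `w ∈ C_s` (through `4`) and `v ∈ C_s` (through `3`)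
compete for the one remaining route — negative association.  The masses are decided by the kernel
with the bitmask reachability of `ReachBits` (`CellMonoRefutation.statusF`); standard axioms; one
seat.
-/

namespace Summit.Ventures.PercRepro2

open MixedBox

/-- The coordinatewise join of two status cells in the order `T < N < S` (`0 < 1 < 2`). -/
def cellJoin (a b : Fin 3 × Fin 3 × Fin 3) : Fin 3 × Fin 3 × Fin 3 :=
  (max a.1 b.1, max a.2.1 b.2.1, max a.2.2 b.2.2)

/-- The coordinatewise meet of two status cells. -/
def cellMeet (a b : Fin 3 × Fin 3 × Fin 3) : Fin 3 × Fin 3 × Fin 3 :=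
  (min a.1 b.1, min a.2.1 b.2.1, min a.2.2 b.2.2)

/-- **The log-supermodular pair inequality** of the three-status law for the cells `a, b`:
`P(σ = a, s↮t) · P(σ = b, s↮t) ≤ P(σ = a∨b, s↮t) · P(σ = a∧b, s↮t)` for every finite graph,
every admissible rational weight vector, roots `s, t` and observed vertices `u, v, w`.
(`{s ↮ t}` is the empty box `boxEvent ∅ ∅`.) -/
def LSMPair (a b : Fin 3 × Fin 3 × Fin 3) : Prop :=
  ∀ (V E : Type) [Fintype V] [DecidableEq V] [Fintype E] [DecidableEq E] (p : E → ℚ),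
    IsProbVec p → ∀ (ends : E → Sym2 V) (s t u v w : V),
    (let Q := MixedBox.boxEvent ends s t u v w ∅ ∅
     prob p (MixedBox.gridEvent ends s t u v w {a} ∩ Q) *
         prob p (MixedBox.gridEvent ends s t u v w {b} ∩ Q) ≤
       prob p (MixedBox.gridEvent ends s t u v w {cellJoin a b} ∩ Q) *
         prob p (MixedBox.gridEvent ends s t u v w {cellMeet a b} ∩ Q))

namespace LSMPairRefutation

/-- The eight edges of the witness graph on seven vertices: `4–6, 4–5, 2–5, 3–0, 0–4, 3–4, 2–3, 3–1`. -/
def ends8 : Fin 8 → Sym2 (Fin 7) :=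
  ![s(4, 6), s(4, 5), s(2, 5), s(3, 0), s(0, 4), s(3, 4), s(2, 3), s(3, 1)]

/-- Numerators of the edge weights. -/
def num8 : Fin 8 → ℕ := ![4095, 1, 1, 255, 4095, 1, 1, 1]

/-- Denominators of the edge weights. -/
def den8 : Fin 8 → ℕ := ![4096, 2, 2, 256, 4096, 2, 2, 2]

/-- The edge weights `4095/4096, 1/2, 1/2, 255/256, 4095/4096, 1/2, 1/2, 1/2`. -/
def p8 : Fin 8 → ℚ := fun e => (num8 e : ℚ) / den8 e

/-- The integer weight of a configuration: `∏_e (num_e if open else den_e − num_e)`. -/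
def wt8 : Config (Fin 8) → ℕ := fun ω => ∏ e, if ω e then num8 e else den8 e - num8 e

/-- The weights are admissible. -/
lemma p8_isProbVec : IsProbVec p8 :=
  ⟨fun e => by fin_cases e <;> norm_num [p8, num8, den8],
   fun e => by fin_cases e <;> norm_num [p8, num8, den8]⟩

/-- `weight p8 ω = wt8 ω / 2³⁷`. -/
lemma p8_weight_eq (ω : Config (Fin 8)) : weight p8 ω = (wt8 ω : ℚ) / 2 ^ 37 := by
  unfold weight wt8
  have hD : (2 : ℚ) ^ 37 = ∏ e : Fin 8, (den8 e : ℚ) := by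
    simp [Fin.prod_univ_eight, den8]; norm_num
  rw [Nat.cast_prod, hD, ← Finset.prod_div_distrib]
  refine Finset.prod_congr rfl fun e _ => ?_
  fin_cases e <;> cases ω _ <;> norm_num [edgeFactor, p8, num8, den8]

/-- Configurations on eight edges as the numbers below `2⁸`. -/
def e8 : Config (Fin 8) ≃ Fin (2 ^ 8) :=
  (Equiv.piCongrRight fun _ => finTwoEquiv.symm).trans finFunctionFinEquiv

/-- The configuration with bit pattern `k`. -/
def cfg8 (k : Fin (2 ^ 8)) : Config (Fin 8) := e8.symm k

/-- A mass on eight edges as a sum over the `2⁸` bit patterns. -/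
lemma mass_eq_sum8 (wt : Config (Fin 8) → ℕ) (A : Set (Config (Fin 8))) [DecidablePred (· ∈ A)] :
    mass wt A = ∑ k : Fin (2 ^ 8), if cfg8 k ∈ A then wt (cfg8 k) else 0 := by
  rw [mass, Finset.sum_filter]
  exact Fintype.sum_equiv e8 _ _ (fun ω => by simp [cfg8])

/-- The cell `(N, N, S)`. -/
def cNNS : Fin 3 × Fin 3 × Fin 3 := (1, 1, 2)
/-- The cell `(N, S, N)`. -/
def cNSN : Fin 3 × Fin 3 × Fin 3 := (1, 2, 1)
/-- The cell `(N, N, T)`. -/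
def cNNT : Fin 3 × Fin 3 × Fin 3 := (1, 1, 0)
/-- The cell `(N, T, N)`. -/
def cNTN : Fin 3 × Fin 3 × Fin 3 := (1, 0, 1)

set_option maxRecDepth 100000 in
set_option maxHeartbeats 4000000 in
/-- The integer masses of the witness (roots `2, 0`, observed `6, 1, 5`):
`m(NSS) · m(NNN) < m(NNS) · m(NSN)`. -/
theorem mass_NNS_NSN :
    mass wt8 (gridEvent ends8 2 0 6 1 5 {cellJoin cNNS cNSN} ∩ boxEvent ends8 2 0 6 1 5 ∅ ∅) *
        mass wt8 (gridEvent ends8 2 0 6 1 5 {cellMeet cNNS cNSN} ∩ boxEvent ends8 2 0 6 1 5 ∅ ∅) <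
      mass wt8 (gridEvent ends8 2 0 6 1 5 {cNNS} ∩ boxEvent ends8 2 0 6 1 5 ∅ ∅) *
        mass wt8 (gridEvent ends8 2 0 6 1 5 {cNSN} ∩ boxEvent ends8 2 0 6 1 5 ∅ ∅) := by
  rw [mass_eq_sum8, mass_eq_sum8, mass_eq_sum8, mass_eq_sum8]
  decide +kernel

set_option maxRecDepth 100000 in
set_option maxHeartbeats 4000000 in
/-- The same graph with the roots exchanged (`s = 0`, `t = 2`): the statuses `S ↔ T` flip, so
`m(NTT) · m(NNN) < m(NNT) · m(NTN)`. -/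
theorem mass_NNT_NTN :
    mass wt8 (gridEvent ends8 0 2 6 1 5 {cellJoin cNNT cNTN} ∩ boxEvent ends8 0 2 6 1 5 ∅ ∅) *
        mass wt8 (gridEvent ends8 0 2 6 1 5 {cellMeet cNNT cNTN} ∩ boxEvent ends8 0 2 6 1 5 ∅ ∅) <
      mass wt8 (gridEvent ends8 0 2 6 1 5 {cNNT} ∩ boxEvent ends8 0 2 6 1 5 ∅ ∅) *
        mass wt8 (gridEvent ends8 0 2 6 1 5 {cNTN} ∩ boxEvent ends8 0 2 6 1 5 ∅ ∅) := by
  rw [mass_eq_sum8, mass_eq_sum8, mass_eq_sum8, mass_eq_sum8]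
  decide +kernel

/-- **Refutation glue**: integer masses with `m(a∨b) m(a∧b) < m(a) m(b)` (all on `{s ↮ t}`) refute
`LSMPair a b`. -/
theorem not_lsmPair_of_mass {n : ℕ} {E : Type} [Fintype E] [DecidableEq E]
    {p : E → ℚ} (hp : IsProbVec p) (ends : E → Sym2 (Fin n)) (s t u v w : Fin n)
    {wt : Config E → ℕ} {D : ℚ} (hD : 0 < D) (hw : ∀ ω, weight p ω = (wt ω : ℚ) / D)
    (a b : Fin 3 × Fin 3 × Fin 3)
    (hm : mass wt (gridEvent ends s t u v w {cellJoin a b} ∩ boxEvent ends s t u v w ∅ ∅) *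
            mass wt (gridEvent ends s t u v w {cellMeet a b} ∩ boxEvent ends s t u v w ∅ ∅) <
          mass wt (gridEvent ends s t u v w {a} ∩ boxEvent ends s t u v w ∅ ∅) *
            mass wt (gridEvent ends s t u v w {b} ∩ boxEvent ends s t u v w ∅ ∅)) :
    ¬ LSMPair a b := by
  intro h
  have key := h (Fin n) E p hp ends s t u v w
  simp only at key
  rw [prob_eq_mass_div hw, prob_eq_mass_div hw, prob_eq_mass_div hw, prob_eq_mass_div hw,
    div_mul_div_comm, div_mul_div_comm] at key
  have hDD : (0 : ℚ) < D * D := by positivity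
  have key' := mul_le_mul_of_nonneg_right key hDD.le
  rw [div_mul_cancel₀ _ hDD.ne', div_mul_cancel₀ _ hDD.ne'] at key'
  norm_cast at key'
  exact absurd key' (not_le.mpr hm)

set_option maxRecDepth 100000 in
set_option maxHeartbeats 1000000 in
/-- **The log-supermodular pair `(NNS, NSN)` is false**: the events `{v ∈ C_s}` and `{w ∈ C_s}` need
not be positively associated given `σ_u = N` (and `t ↮ v, w`, `s ↮ t`). -/
theorem not_lsmPair_NNS_NSN : ¬ LSMPair cNNS cNSN :=
  not_lsmPair_of_mass (wt := wt8) (D := 2 ^ 37) p8_isProbVec ends8 2 0 6 1 5 (by norm_num)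
    p8_weight_eq cNNS cNSN mass_NNS_NSN

set_option maxRecDepth 100000 in
set_option maxHeartbeats 1000000 in
/-- **The mirror pair `(NNT, NTN)` is false — the candidate (MIX-1)**: in the box
`{σ_u, σ_v, σ_w ∈ {T, N}}` (the cluster of `s` avoids `u, v, w`) the events `{σ_v = N}` and
`{σ_w = N}` need not be positively associated given `σ_u = N`. -/
theorem not_lsmPair_NNT_NTN : ¬ LSMPair cNNT cNTN :=
  not_lsmPair_of_mass (wt := wt8) (D := 2 ^ 37) p8_isProbVec ends8 0 2 6 1 5 (by norm_num)
    p8_weight_eq cNNT cNTN mass_NNT_NTN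

end LSMPairRefutation

end Summit.Ventures.PercRepro2
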